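import Literature.Probability.RandomPlanarGeometry.LoewnerThrClock
import Literature.Probability.RandomPlanarGeometry.LoewnerThrPieces
import Literature.Probability.RandomPlanarGeometry.LoewnerImageFlow
import Literature.Probability.RandomPlanarGeometry.SLEImageBM
import Literature.Probability.Process.MartingaleClockTimeChangeAE
import Literature.Probability.Process.BrownianConcatenationAE
import HarnessLib

/-!
# The through-swallow image Brownian motion of SLE₆ under a `*`-hull (DDS packaging, a.s. version)

Topic `Probability/RandomPlanarGeometry`; one theorem (crux `stmt-CriticalPhenomena-0698`, stub
`stub_isLocal`, through-swallow image chain of the locality of SLE₆; Lawler–Schramm–Werner (2001)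
Thm. 2.2), version for a strongly progressive MODIFICATION `Ỹ` of the stopped through-swallow image
driving value with almost surely continuous paths (the form the stochastic gluing delivers: at the
horizon instant the raw driver is meaningful only for curve-generated paths). Otherwise as
`SLEThrImageBM.lean`: the
Dambis–Dubins–Schwarz packaging of `SLEImageBM.exists_sle_image_brownian` transposed to the
through-swallow image driving value `thrImageDriver` stopped at a bounded horizon `H` with the
through-swallow clock `thrClock` (`LoewnerRemainingHull.lean`, clock API `LoewnerThrClock.lean`):
given the martingale clock structure of the stopped process (the stochastic gluing, stub
`stub_thrGluing`) together with its adaptedness / continuity by-products and the integrability of the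
clock rate up to the horizon, there is a real Brownian motion `Bc` on the product of two Wiener spaces
with `√6 · Bc s = thrImageDriverC W A T₀ s` for `s ≤ σ(T₀)`, `T₀ = H > 0` (time change by the clock,
`HasMartingaleClock.timeChange`; concatenation with an independent Brownian motion,
`isBrownianReal_concat`; read back through `tcProc_clock`).
-/

noncomputable section

open Set Filter Function MeasureTheory ProbabilityTheory
open _root_.Topology
open Literature.Probability.Process
open scoped NNReal

namespace Literature.Probability.RandomPlanarGeometry

open Loewner PathOps


/-- **The through-swallow image Brownian motion from a progressive modification** (DDS packaging,
a.s. version). With `W = drvK 6 (brownianCPath ω)` and the clock `c t ω = thrClock W A (t ∧ H)`: if a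
strongly progressive process `Ỹ` with `Ỹ 0 = 0`, almost surely continuous paths, almost surely equal to
`(√6)⁻¹ · thrImageDriver W A t` for `t ≤ H`, carries the martingale clock `c` (bound `C`) for the
Brownian filtration, `c` is adapted, `H` is a stopping time bounded by the constant `T` and the clock
rate is integrable up to the horizon, then there is a real Brownian motion `Bc` on the product of two
Wiener spaces (measurable marginals, continuous paths at EVERY sample) with
`√6 · Bc s z = thrImageDriverC W A T₀ s` for ALMOST EVERY `z`, whenever `H z.1 = T₀ > 0` and
`s ≤ thrClock W A T₀`. [cite: LawlerSchrammWerner2001, Thm. 2.2] -/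
theorem exists_thr_image_brownian_of_hasMartingaleClock_ae (A : Set ℂ) {H : (ℝ≥0 → ℝ) → WithTop ℝ≥0}
    {T : ℝ≥0} {C : ℝ} {Yt : ℝ≥0 → (ℝ≥0 → ℝ) → ℝ} (hHst : IsStoppingTime brownianFiltration H)
    (hHT : ∀ ω, H ω ≤ (T : WithTop ℝ≥0))
    (hclock : HasMartingaleClock Yt
      (fun t ω ↦ thrClock (drvK 6 (brownianCPath ω)) A (min (t : ℝ) (((H ω).untopD 0 : ℝ≥0) : ℝ)))
      brownianFiltration preWienerMeasure C)
    (hYprog : IsStronglyProgressive brownianFiltration Yt)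
    (hYc : ∀ᵐ ω ∂preWienerMeasure, Continuous fun t ↦ Yt t ω)
    (hY0 : ∀ ω, Yt 0 ω = 0)
    (hYeq : ∀ᵐ ω ∂preWienerMeasure, ∀ t : ℝ≥0, (t : WithTop ℝ≥0) ≤ H ω →
      Yt t ω = (Real.sqrt 6)⁻¹ * thrImageDriver (drvK 6 (brownianCPath ω)) A t)
    (hcad : Adapted brownianFiltration
      (fun t ω ↦ thrClock (drvK 6 (brownianCPath ω)) A (min (t : ℝ) (((H ω).untopD 0 : ℝ≥0) : ℝ))))
    (hint : ∀ ω, IntegrableOn (thrClockRate (drvK 6 (brownianCPath ω)) A)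
      (Icc (0 : ℝ) (((H ω).untopD 0 : ℝ≥0) : ℝ))) :
    ∃ Bc : ℝ≥0 → (ℝ≥0 → ℝ) × (ℝ≥0 → ℝ) → ℝ,
      IsBrownianReal Bc (preWienerMeasure.prod preWienerMeasure) ∧
      (∀ s, Measurable (Bc s)) ∧ (∀ z, Continuous (Bc · z)) ∧
      ∀ᵐ z ∂(preWienerMeasure.prod preWienerMeasure), ∀ T₀ : ℝ≥0, H z.1 = T₀ → 0 < T₀ →
        ∀ s : ℝ≥0, (s : ℝ) ≤ thrClock (drvK 6 (brownianCPath z.1)) A T₀ →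
          Real.sqrt 6 * Bc s z = thrImageDriverC (drvK 6 (brownianCPath z.1)) A T₀ s := by
  classical
  haveI := isProbabilityMeasure_preWienerMeasure'
  have h6 : (0 : ℝ) < Real.sqrt 6 := Real.sqrt_pos.2 (by norm_num)
  set P : Measure (ℝ≥0 → ℝ) := preWienerMeasure with hPdef
  set ρ : (ℝ≥0 → ℝ) → ℝ≥0 := fun ω ↦ (H ω).untopD 0 with hρdef
  have hHtop : ∀ ω, H ω ≠ ⊤ := fun ω ↦ ne_top_of_le_ne_top WithTop.coe_ne_top (hHT ω)
  have hρcoe : ∀ ω, (ρ ω : WithTop ℝ≥0) = H ω := fun ω ↦ by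
    obtain ⟨a, ha⟩ := WithTop.ne_top_iff_exists.1 (hHtop ω)
    rw [hρdef]; simp only; rw [← ha, WithTop.untopD_coe]
  set Y := Yt with hYdef
  set c : ℝ≥0 → (ℝ≥0 → ℝ) → ℝ := fun t ω ↦
    thrClock (drvK 6 (brownianCPath ω)) A (min (t : ℝ) (((H ω).untopD 0 : ℝ≥0) : ℝ)) with hcdef
  set 𝓕 : Filtration ℝ≥0 (inferInstance : MeasurableSpace (ℝ≥0 → ℝ)) := brownianFiltration with h𝓕
  have hcρ : ∀ t ω, c t ω = thrClock (drvK 6 (brownianCPath ω)) A (min (t : ℝ) (ρ ω)) := fun t ω ↦ rfl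
  -- Step 1: the time change (progressive version)
  have hρst : IsStoppingTime 𝓕 fun ω ↦ (ρ ω : WithTop ℝ≥0) := by
    have heq : (fun ω ↦ (ρ ω : WithTop ℝ≥0)) = H := funext hρcoe
    rw [heq]; exact hHst
  have hρT : ∀ ω, ρ ω ≤ T := fun ω ↦ by
    have := hHT ω; rw [← hρcoe] at this; exact WithTop.coe_le_coe.1 this
  have hfrozen : ∀ t ω, c t ω = c (min t (ρ ω)) ω := by
    intro t ω
    rw [hcρ, hcρ, NNReal.coe_min, min_assoc, min_self]
  have htc := hclock.timeChange_of_isStronglyProgressive hYprog hYc hcad hρst hρT hfrozen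
  have hcc := hclock.continuous_clock
  have hc0 := hclock.clock_zero
  have hmono := hclock.monotone_clock
  have hnn : ∀ t ω, 0 ≤ c t ω := fun t ω ↦ hclock.clock_nonneg ω t
  have hstrict : ∀ ω, StrictMonoOn (fun t ↦ c t ω) (Icc 0 (ρ ω)) := by
    intro ω s hs t ht hst
    show c s ω < c t ω
    rw [hcρ, hcρ, min_eq_left (NNReal.coe_le_coe.2 hs.2), min_eq_left (NNReal.coe_le_coe.2 ht.2)]
    exact strictMonoOn_thrClock (hint ω) ⟨s.coe_nonneg, NNReal.coe_le_coe.2 hs.2⟩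
      ⟨t.coe_nonneg, NNReal.coe_le_coe.2 ht.2⟩ (NNReal.coe_lt_coe.2 hst)
  set 𝒢 := tcFiltration hcad hcc hρst with h𝒢def
  -- Step 2: concatenation with an independent Brownian motion (a.s.-continuous version)
  set σc : (ℝ≥0 → ℝ) → ℝ≥0 := fun ω ↦ (totalClock c ρ ω).toNNReal with hσcdef
  have hσc0 : ∀ ω, 0 ≤ totalClock c ρ ω := fun ω ↦ hclock.clock_nonneg ω _
  have hσccoe : ∀ ω, ((σc ω : ℝ≥0) : ℝ) = totalClock c ρ ω := fun ω ↦ Real.coe_toNNReal _ (hσc0 ω)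
  have hmin_eq : ∀ (s : ℝ≥0) ω, min (s : ℝ) (totalClock c ρ ω) = ((min s (σc ω) : ℝ≥0) : ℝ) := by
    intro s ω; rw [NNReal.coe_min, hσccoe]
  have htc' : HasMartingaleClock (tcProc Y c ρ) (fun s ω ↦ ((min s (σc ω) : ℝ≥0) : ℝ)) 𝒢 P C := by
    have heq : (fun (s : ℝ≥0) ω ↦ ((min s (σc ω) : ℝ≥0) : ℝ)) =
        fun (s : ℝ≥0) ω ↦ min (s : ℝ) (totalClock c ρ ω) := by
      funext s ω; exact (hmin_eq s ω).symm
    rw [heq]; exact htc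
  have hcontY : ∀ᵐ ω ∂P, Continuous fun s ↦ tcProc Y c ρ s ω := by
    filter_upwards [hYc] with ω hω
    exact continuous_tcProc_of_continuous hω hc0 hcc hmono hstrict
  have hYad' : ∀ s, StronglyMeasurable[𝒢 s] (tcProc Y c ρ s) := fun s ↦
    (measurable_tcProc hcad hcc hρst hYprog s).stronglyMeasurable
  have hσcm : Measurable σc := (measurable_totalClock hcad hcc hρst).real_toNNReal
  have hcad' : ∀ s : ℝ≥0, Measurable[𝒢 s] fun ω ↦ min s (σc ω) := by
    intro s
    have h1 := (measurable_min_totalClock hcad hcc hρst hc0 hmono hfrozen s).real_toNNReal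
    have heq : (fun ω ↦ (min (s : ℝ) (totalClock c ρ ω)).toNNReal) = fun ω ↦ min s (σc ω) := by
      funext ω; rw [hmin_eq, Real.toNNReal_coe]
    rwa [heq] at h1
  have hY0' : ∀ ω, tcProc Y c ρ 0 ω = 0 := fun ω ↦ by rw [tcProc_zero hc0]; exact hY0 ω
  set M : ℝ≥0 → (ℝ≥0 → ℝ) × (ℝ≥0 → ℝ) → ℝ := fun s z ↦ tcProc Y c ρ s z.1 +
    (Process.brownian s z.2 - Process.brownian (min s (σc z.1)) z.2) with hMdef
  have hBM : IsBrownianReal M (P.prod preWienerMeasure) :=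
    isBrownianReal_concat_ae htc' hcontY hYad' hσcm hcad' hY0' rfl
  have hMm : ∀ t, Measurable (M t) := measurable_concat hMdef hYad' hcad'
  -- Step 2': modification to continuous paths at every sample
  obtain ⟨N₁, hN₁sub, hN₁m, hN₁0⟩ := exists_measurable_superset_of_null (ae_iff.1 hcontY)
  set M' : ℝ≥0 → (ℝ≥0 → ℝ) × (ℝ≥0 → ℝ) → ℝ := fun s z ↦ if z.1 ∈ N₁ then 0 else M s z with hM'def
  have hM'm : ∀ t, Measurable (M' t) := fun t ↦
    Measurable.ite (hN₁m.preimage measurable_fst) measurable_const (hMm t)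
  have hM'c : ∀ z, Continuous (M' · z) := by
    rintro ⟨ω, ω'⟩
    by_cases hω : ω ∈ N₁
    · simp only [hM'def, hω, if_true]
      exact continuous_const
    · simp only [hM'def, hω, if_false]
      have hωc : Continuous fun s ↦ tcProc Y c ρ s ω := by
        by_contra h; exact hω (hN₁sub h)
      exact hωc.add ((Process.continuous_brownian ω').sub
        ((Process.continuous_brownian ω').comp (continuous_id.min continuous_const)))
  have hnull : ∀ᵐ z ∂(P.prod preWienerMeasure), z.1 ∉ N₁ := by
    have : ∀ᵐ ω ∂P, ω ∉ N₁ := measure_eq_zero_iff_ae_notMem.1 hN₁0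
    exact Measure.quasiMeasurePreserving_fst.ae this
  have hBM' : IsBrownianReal M' (P.prod preWienerMeasure) := by
    refine ⟨hBM.toIsPreBrownianReal.congr fun t ↦ ?_, ae_of_all _ hM'c⟩
    filter_upwards [hnull] with z hz
    simp only [hM'def, hz, if_false]
  refine ⟨M', hBM', hM'm, hM'c, ?_⟩
  -- Step 3: agreement with the through-swallow image driver in capacity time, almost surely
  filter_upwards [hnull, Measure.quasiMeasurePreserving_fst.ae hYeq] with z hz hzeq
  rintro T₀ hT₀ hT0 s hs
  obtain ⟨ω, ω'⟩ := z
  simp only at hT₀ hs hz hzeq ⊢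
  set W := drvK 6 (brownianCPath ω) with hWdef
  have hρω : ρ ω = T₀ := WithTop.coe_injective ((hρcoe ω).trans hT₀)
  have hintω : IntegrableOn (thrClockRate W A) (Icc (0 : ℝ) T₀) := by rw [← hρω]; exact hint ω
  have hsI : (s : ℝ) ∈ Icc (0 : ℝ) (thrClock W A T₀) := ⟨s.coe_nonneg, hs⟩
  obtain ⟨htI, hσt⟩ := thrClockInv_spec hintω hsI
  set t : ℝ := thrClockInv W A T₀ s with htdef
  set t' : ℝ≥0 := t.toNNReal with ht'def
  have ht'coe : (t' : ℝ) = t := Real.coe_toNNReal _ htI.1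
  have ht'le : t' ≤ T₀ := by
    have := Real.toNNReal_le_toNNReal htI.2; rwa [Real.toNNReal_coe] at this
  have ht'ρ : t' ≤ ρ ω := hρω ▸ ht'le
  have ht'H : ((t' : ℝ≥0) : WithTop ℝ≥0) ≤ H ω := by rw [← hρcoe]; exact WithTop.coe_le_coe.2 ht'ρ
  have hct' : c t' ω = s := by
    rw [hcρ, min_eq_left (NNReal.coe_le_coe.2 ht'ρ), ← hWdef, ht'coe, hσt]
  have hYt' : Y t' ω = (Real.sqrt 6)⁻¹ * thrImageDriver W A t' := hzeq t' ht'H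
  have hle : s ≤ σc ω := by
    rw [← NNReal.coe_le_coe, hσccoe, totalClock, ← hct']
    exact hmono ω ht'ρ
  have hMs : M' s (ω, ω') = Y t' ω := by
    have h0 : M' s (ω, ω') = M s (ω, ω') := by simp only [hM'def, hz, if_false]
    have hcat : M s (ω, ω') = tcProc Y c ρ s ω :=
      @concat_eq_of_le _ (tcProc Y c ρ) σc M hMdef s (ω, ω') hle
    rw [h0, hcat]
    have h1 := tcProc_clock (Y := Y) hcc hstrict hnn ht'ρ
    change tcProc Y c ρ (c t' ω).toNNReal ω = Y t' ω at h1
    rw [hct', Real.toNNReal_coe] at h1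
    exact h1
  rw [hMs, hYt', ← mul_assoc, mul_inv_cancel₀ h6.ne', one_mul, thrImageDriverC, min_eq_left hs]

end Literature.Probability.RandomPlanarGeometry

end
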